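import Summits.CriticalPhenomena.PercolationContinuityZ3.Theses.PercNonProliferation
import Summits.CriticalPhenomena.PercolationContinuityZ3.Theorems.PercNonProliferationNonProliferationJumpFragmentation
import Summits.CriticalPhenomena.PercolationContinuityZ3.Theorems.PercNonProliferationNonProliferationFewClasses
import Summits.CriticalPhenomena.PercolationContinuityZ3.Theorems.PercNonProliferationNonProliferationStubJumpFiniteDebrisTight
import Summits.CriticalPhenomena.PercolationContinuityZ3.Theorems.PercNonProliferationNonProliferationStubContSureResidue
import HarnessLib

/-!
# SplitCertificate — crux-strategist s1 (stmt-CriticalPhenomena-4444): the three children of the split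
`NonProliferation ⟸ InfiniteClusterFewClasses (ChildOne) ∧ JumpFiniteDebrisTight (ChildTwo) ∧ ContSureResidue (ChildThree)`, spelled EXACTLY as
they are filed in `children.json` (route-file context: fully qualified names), and the certificate that the
landed theorem `Theorems.NonProliferation.nonProliferation_of_fewClasses_of_debris_of_residue` (p145944) has
type `C₁ → C₂ → C₃ → NonProliferation` against these spellings — which is what
`ledger route edit --split NonProliferation --into children.json --glue-by …` elaborates.
-/

namespace Summit.CriticalPhenomena.PercolationContinuityZ3.Cruxes.NonProliferation.SplitCertificate

open scoped BigOperators Topology Classical MeasureTheory ProbabilityTheory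
open Filter Set Function TopologicalSpace MeasureTheory
open Summit.CriticalPhenomena.PercolationContinuityZ3.Theses.PercNonProliferation (NonProliferation FreeBoxSparse)

/-! The three children are declared here under the local names `ChildOne/Two/Three` (NOT under their route-file names
`InfiniteClusterFewClasses` / `JumpFiniteDebrisTight` / `ContSureResidue`), so that this workfile keeps elaborating after the
gate writes those decls into `Theses/PercNonProliferation.lean`; the statement TEXT is byte-identical to `children.json`. -/

/-- child 1 (crux): S1 of line `jump-fragmentation` — the critical infinite cluster, if any, meets `B(n)` in
boundedly many `B(2n)`-connection classes, with probability `≥ c`, infinitely often. -/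
def ChildOne : Prop :=
  ∃ (M : ℕ) (c : ℝ), 0 < c ∧ ∃ᶠ n : ℕ in Filter.atTop, c ≤ (Literature.Probability.Percolation.bondPercolation (Literature.Probability.LatticeModels.zdGraph 3) (Literature.Probability.Percolation.criticalProbI 3)).real {ω | ¬ ∃ x : Fin (M + 1) → Literature.Probability.LatticeModels.Site 3, (∀ i, x i ∈ Literature.Probability.LatticeModels.box 3 n) ∧ (∀ i, ω ∈ Literature.Probability.Percolation.percolatesAt (x i)) ∧ ∀ i j, i ≠ j → ω ∉ Literature.Probability.Percolation.openConnIn ↑(Literature.Probability.LatticeModels.box 3 (2 * n)) (x i) (x j)}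

/-- child 2 (crux, to be HELD behind stmt-CriticalPhenomena-0943): S2 — in a jump world the finite spanning debris is tight. -/
def ChildTwo : Prop :=
  0 < Literature.Probability.Percolation.theta (Literature.Probability.LatticeModels.zdGraph 3) 0 (Literature.Probability.Percolation.criticalProbI 3) → ∀ ε : ℝ, 0 < ε → ∃ M : ℕ, ∀ᶠ n : ℕ in Filter.atTop, (Literature.Probability.Percolation.bondPercolation (Literature.Probability.LatticeModels.zdGraph 3) (Literature.Probability.Percolation.criticalProbI 3)).real {ω | ∃ x : Fin (M + 1) → Literature.Probability.LatticeModels.Site 3, (∀ i, x i ∈ Literature.Probability.LatticeModels.box 3 n) ∧ (∀ i, ω ∉ Literature.Probability.Percolation.percolatesAt (x i)) ∧ (∀ i, ∃ y ∈ Literature.Probability.LatticeModels.innerBoundary (Literature.Probability.LatticeModels.zdGraph 3) (Literature.Probability.LatticeModels.box 3 (2 * n)), ω ∈ Literature.Probability.Percolation.openConnIn ↑(Literature.Probability.LatticeModels.box 3 (2 * n)) (x i) y) ∧ ∀ i j, i ≠ j → ω ∉ Literature.Probability.Percolation.openConnIn ↑(Literature.Probability.LatticeModels.box 3 (2 * n))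 (x i) (x j)} ≤ ε

/-- child 3 (crux, to be HELD behind stmt-CriticalPhenomena-5247): S3 — the crux in a continuous world with sure crossing. -/
def ChildThree : Prop :=
  Literature.Probability.Percolation.theta (Literature.Probability.LatticeModels.zdGraph 3) 0 (Literature.Probability.Percolation.criticalProbI 3) = 0 → (∀ k : ℕ, 2 ≤ k → Filter.Tendsto (fun m : ℕ => (Literature.Probability.Percolation.bondPercolation (Literature.Probability.LatticeModels.zdGraph 3) (Literature.Probability.Percolation.criticalProbI 3)).real {ω | ∃ x ∈ Literature.Probability.LatticeModels.box 3 m, ∃ y ∈ Literature.Probability.LatticeModels.innerBoundary (Literature.Probability.LatticeModels.zdGraph 3) (Literature.Probability.LatticeModels.box 3 (k * m)), ω ∈ Literature.Probability.Percolation.openConnIn ↑(Literature.Probability.LatticeModels.box 3 (k * m)) x y}) Filter.atTop (nhds 1)) → ∃ (M : ℕ) (c : ℝ), 0 < c ∧ ∃ᶠ n : ℕ in Filter.atTop, c ≤ (Literature.Probability.Percolation.bondPercolation (Literature.Probability.LatticeModels.zdGraph 3) (Literature.Probability.Percolation.criticalProbI 3)).real {ω | ¬ ∃ x : Fin (M +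 1) → Literature.Probability.LatticeModels.Site 3, (∀ i, x i ∈ Literature.Probability.LatticeModels.box 3 n) ∧ (∀ i, ∃ y ∈ Literature.Probability.LatticeModels.innerBoundary (Literature.Probability.LatticeModels.zdGraph 3) (Literature.Probability.LatticeModels.box 3 (2 * n)), ω ∈ Literature.Probability.Percolation.openConnIn ↑(Literature.Probability.LatticeModels.box 3 (2 * n)) (x i) y) ∧ ∀ i j, i ≠ j → ω ∉ Literature.Probability.Percolation.openConnIn ↑(Literature.Probability.LatticeModels.box 3 (2 * n)) (x i) (x j)}

/-- **Glue-by certificate**: the landed composition (p145944) has exactly the type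
`C₁ → C₂ → C₃ → NonProliferation` for the children as spelled above (term mode, no tactic unfolding). -/
theorem nonProliferation_of_children :
    ChildOne → ChildTwo → ChildThree → NonProliferation :=
  Summit.CriticalPhenomena.PercolationContinuityZ3.Theorems.NonProliferation.nonProliferation_of_fewClasses_of_debris_of_residue

/-- Identity with the registered stub spelling `Stubs.stub_infiniteClusterFewClasses` of `Lines/jump_fragmentation.lean`
(checked by `Iff.rfl` against the imported skeleton in the strategist folder's `SplitCheck.lean`; the skeleton is not imported
here so that this certificate does not depend on a sorried module). The right-hand side below is that stub's text. -/
example : ChildOne ↔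
    (∃ (M : ℕ) (c : ℝ), 0 < c ∧ ∃ᶠ n : ℕ in Filter.atTop, c ≤ (Literature.Probability.Percolation.bondPercolation
      (Literature.Probability.LatticeModels.zdGraph 3) (Literature.Probability.Percolation.criticalProbI 3)).real
      {ω | ¬ ∃ x : Fin (M + 1) → Literature.Probability.LatticeModels.Site 3,
        (∀ i, x i ∈ Literature.Probability.LatticeModels.box 3 n) ∧
        (∀ i, ω ∈ Literature.Probability.Percolation.percolatesAt (x i)) ∧
        ∀ i j, i ≠ j → ω ∉ Literature.Probability.Percolation.openConnIn
          (↑(Literature.Probability.LatticeModels.box 3 (2 * n)) : Set (Literature.Probability.LatticeModels.Site 3)) (x i) (x j)}) :=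
  Iff.rfl

/-- The route's whole content rides on child 1 (landed p145974): `FreeBoxSparse → ChildOne → S`.
(For the tenure planner: this is the honest re-glue of `closes`.) -/
theorem closes_on_child_one (hSparse : FreeBoxSparse) (hS1 : ChildOne) :
    _root_.PercolationContinuityZ3 :=
  Summit.CriticalPhenomena.PercolationContinuityZ3.Theorems.NonProliferation.continuity_of_freeBoxSparse_of_fewClasses
    hSparse hS1

/-- Directions that DO hold (the converse piece probes `Cᵢ → NonProliferation`, `Cᵢ → S` are expected to fail). -/
theorem child_one_of_crux (h : NonProliferation) : ChildOne :=
  Summit.CriticalPhenomena.PercolationContinuityZ3.Theorems.NonProliferation.infiniteClusterFewClasses_of_nonProliferation h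

theorem child_one_of_summit (h : _root_.PercolationContinuityZ3) : ChildOne :=
  Summit.CriticalPhenomena.PercolationContinuityZ3.Theorems.NonProliferation.infiniteClusterFewClasses_of_continuity h

/-- child 2 ⟸ stmt-0943 `PercDebrisSweep.FiniteClusterVolumeTail` (landed bridge p147786, `M = 0`). -/
theorem child_two_of_finiteClusterVolumeTail
    (h : Summit.CriticalPhenomena.PercolationContinuityZ3.Theses.PercDebrisSweep.FiniteClusterVolumeTail) :
    ChildTwo :=
  Summit.CriticalPhenomena.PercolationContinuityZ3.Theorems.NonProliferation.jumpFiniteDebrisTight_of_finiteClusterVolumeTail h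

/-- child 3 ⟸ stmt-5247 `PercBudgetLadder.CritAnnulusBlockedIO` (landed bridge p147999, vacuous). -/
theorem child_three_of_critAnnulusBlockedIO
    (h : Summit.CriticalPhenomena.PercolationContinuityZ3.Theses.PercBudgetLadder.CritAnnulusBlockedIO) :
    ChildThree :=
  Summit.CriticalPhenomena.PercolationContinuityZ3.Theorems.NonProliferation.contSureResidue_of_critAnnulusBlockedIO h

end Summit.CriticalPhenomena.PercolationContinuityZ3.Cruxes.NonProliferation.SplitCertificate
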